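import Literature.NumberTheory.EllipticCurves.BurungaleSkinnerTianWan2024.OrdinaryTwoVariableMainStatementTwistReplayProofs
import Literature.NumberTheory.EllipticCurves.BSDSelmerSmithRootNumberDensityProofs
import Literature.NumberTheory.EllipticCurves.RootNumberSmulProofs
import HarnessLib

/-!
# BSTW arXiv:2409.01350v2 Thm. 10.10 (b), quadratic-twist clauses: the conductor side condition
# `(N_{E₀^{(d)}}, D_L) = 1` DISCHARGED from `(d, D_L) = 1` (proofs only)

A *proofs* file (theorems only: no definition, no named fact, no instance, no `sorry`) written by the
typer seat `bsd-littype-04` (gen 9) of the cross-ladder literature-typing layer (D-0088(4); cell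
`run/shared/lean/pub/bsd-littype/`), companion of seat `bsd-littype-01`'s
`OrdinaryTwoVariableMainStatementTwistReplayProofs.lean` (gen 8; the twist clauses of Thm. 10.10 (b),
case `· = ∅`, replayed from the Thm. 10.5 twist binder).  That file carries, besides `(d, D_L) = 1`
(`hdD`), the separate hypothesis `(N, D_L) = 1` for the conductor `N = N_{E₀^{(d)}}` of the twist
(`hNd`; its module docstring: "it follows from `(d, D_L) = 1` and `(N₀, D_L) = 1` since
`N_{E₀^{(d)}} ∣ 2^∗ N₀ d²`, a conductor computation not composed here").  This file COMPOSES it: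

* `isCoprime_conductorNorm_of_smul_eq_quadraticTwist` — for any `W₀, W` over `ℚ` with
  `C • W = W₀^{(d)}` (`d ≠ 0`) and any ODD integer `m` prime to `N_{W₀}` and to `d`:
  `(N_W, m) = 1`.  A prime `q ∣ m` is odd, `∤ N_{W₀}`, `∤ d`, hence `∤ N_{W₀^{(d)}}`
  (`not_dvd_conductorNorm_quadraticTwist_of_not_dvd`: good reduction persists under a twist unramified
  at `q`, Silverman *AEC* VII.5 Prop. 5.1), and `N_W = N_{C • W}` (`WeierstrassCurve.conductorNorm_smul`);
* `isCoprime_level_discr_of_smul_eq_quadraticTwist` — under `Thm1010bHypotheses W₀ p N₀ K` (so `D_L`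
  odd and `(N₀, D_L) = 1`): `(d, D_L) = 1 ⟹ (N, D_L) = 1` for `(N : ℤ) = N_{E₀^{(d)}}`;
* `hNd`-free forms of seat 01's five twist theorems (`…_of_coprime`): the reverse inclusion, the
  9.10-`∅` twist clause (O2-fed and [SU14]-fed), the 9.12-`∅` twist clause (O2-fed and [SU14]-fed) —
  each is the sibling theorem with `hNd` supplied by `isCoprime_level_discr_of_smul_eq_quadraticTwist`.

So the kernel replay of the twist clauses is WEAKER than the gen-7 twist binders by exactly
`(d, D_L) = 1`, the cyclotomic/anticyclotomic coordinates with `γ₁|_{ℚ_∞}` normalised, and (9.12)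
`D_L ≠ −3` — no longer by `(N, D_L) = 1`.  HONEST FRAMING: typed ≠ proved ≠ endorsed; nothing here
proves BSD or a main "conj."; every statement about the twist clauses is CONDITIONAL on the named
binders / facts it lists (the Thm. 10.5 twist binder is an OPEN claim of an UNREFEREED preprint).
Net: 0 definitions, 0 facts.

## References
* [BurungaleSkinnerTianWan2024] arXiv:2409.01350v2: Thm. 10.10, last sentence (p. 89; tex l.7525);
  Thm. 10.5, last sentence (p. 88; l.7403); proof of Thm. 10.8 (pp. 88–89).
* [SilvermanAEC2009] VII.5 Prop. 5.1 (good reduction under an unramified twist), X.5 Cor. 5.4.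
* [YanZhu2024MainConjNonCM] J. Algebra 693 (2026): the standing hypothesis `(N, D_K) = 1` of Cor. 2.9 /
  Thm. 3.3 / Prop. 3.7 / Thm. 4.7 / Lemma 5.3 (arXiv:2412.20078v4 §2.1).
-/

noncomputable section

open scoped Classical

open PowerSeries NumberField IsDedekindDomain Field CongruenceSubgroup
  Literature.NumberTheory.GaloisRepresentations Literature.NumberTheory.EllipticCurves
  Literature.NumberTheory.EllipticCurves.ModularForms Literature.NumberTheory.EllipticCurves.Rank1Residual

namespace Literature.NumberTheory.EllipticCurves.BurungaleSkinnerTianWan2024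

open IwasawaAlgebra₂ YanZhu2026 BurungaleCastellaSkinner2025 SkinnerUrban2014
  Literature.NumberTheory.Automorphic

/-! ## §1. The conductor of a quadratic twist is prime to an odd modulus prime to `N₀ d` -/

/-- **`(N_{W₀^{(d)}}, m) = 1` for `m` odd, prime to `N_{W₀}` and to `d`** (any model `W` of the
twist, `C • W = W₀^{(d)}`, `d ≠ 0`): every prime `q ∣ m` is odd, does not divide `N_{W₀}` and does not
divide `d`, so `W₀^{(d)}` has good reduction at `q` and `q ∤ N_{W₀^{(d)}} = N_W` (tree theorems
`not_dvd_conductorNorm_quadraticTwist_of_not_dvd`, `WeierstrassCurve.conductorNorm_smul`).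
[cite: SilvermanAEC2009, VII.5 Prop. 5.1] -/
theorem isCoprime_conductorNorm_of_smul_eq_quadraticTwist (W₀ W : WeierstrassCurve ℚ) [W₀.IsElliptic]
    [W.IsElliptic] {d : ℤ} (hd0 : d ≠ 0) {C : WeierstrassCurve.VariableChange ℚ}
    (hC : C • W = W₀.quadraticTwist (d : ℚ)) {m : ℤ} (hm : Odd m)
    (hN₀ : IsCoprime (W₀.conductorNorm ℤ : ℤ) m) (hdm : IsCoprime d m) :
    IsCoprime (W.conductorNorm ℤ : ℤ) m := by
  have hNW : W.conductorNorm ℤ = (W₀.quadraticTwist (d : ℚ)).conductorNorm ℤ := by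
    rw [← WeierstrassCurve.conductorNorm_smul ℤ W C, hC]
  have hcop : Nat.Coprime (W.conductorNorm ℤ) m.natAbs := by
    refine Nat.coprime_of_dvd fun q hq hqN hqm ↦ ?_
    have hqm' : (q : ℤ) ∣ m := Int.natCast_dvd.mpr hqm
    have hq2 : q ≠ 2 := by
      rintro rfl
      rw [← Int.not_even_iff_odd, even_iff_two_dvd] at hm
      exact hm (by exact_mod_cast hqm')
    have h2 := hq.two_le
    have hqN₀ : ¬ q ∣ W₀.conductorNorm ℤ := by
      intro h
      have hu : IsUnit (q : ℤ) := hN₀.isUnit_of_dvd' (by exact_mod_cast h) hqm'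
      rcases Int.isUnit_iff.mp hu with h1 | h1 <;> omega
    have hqd : ¬ (q : ℤ) ∣ d := by
      intro h
      have hu : IsUnit (q : ℤ) := hdm.isUnit_of_dvd' h hqm'
      rcases Int.isUnit_iff.mp hu with h1 | h1 <;> omega
    exact not_dvd_conductorNorm_quadraticTwist_of_not_dvd W₀ hq hq2 hqN₀ hd0 hqd (hNW ▸ hqN)
  have h := Nat.isCoprime_iff_coprime.mpr hcop
  rcases Int.natAbs_eq m with hm' | hm'
  · rw [hm']
    exact h
  · rw [hm', IsCoprime.neg_right_iff]
    exact h

/-- **Under the block of Thm. 10.10 (b), `(d, D_L) = 1 ⟹ (N_{E₀^{(d)}}, D_L) = 1`**: `D_L` is odd and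
prime to `N₀ = N_{E₀}` (`Thm1010bHypotheses`: "`(D_L, 2N) = 1`"), so the previous theorem applies with
`m = D_L`.  This is the hypothesis `hNd` of seat 01's twist replay, now a consequence of `hdD`.
[cite: BurungaleSkinnerTianWan2024, Thm. 10.10, last sentence ("(D_K, Np) = 1") with Thm. 10.5 ("(D_L, 2N) = 1") (bookkeeping)] -/
theorem isCoprime_level_discr_of_smul_eq_quadraticTwist {p : ℕ} [Fact p.Prime]
    {W₀ W : WeierstrassCurve ℚ} [W₀.IsElliptic] [W₀.IsGloballyMinimal] [W.IsElliptic] {d : ℤ}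
    {C : WeierstrassCurve.VariableChange ℚ} {K : Type} [Field K] [NumberField K] {N₀ N : ℕ}
    (hyp : Thm1010bHypotheses W₀ p N₀ K) (hd0 : d ≠ 0) (hC : C • W = W₀.quadraticTwist (d : ℚ))
    (hN : (N : ℤ) = W.conductorNorm ℤ) (hdD : IsCoprime d (NumberField.discr K)) :
    IsCoprime (N : ℤ) (NumberField.discr K) :=
  hN ▸ isCoprime_conductorNorm_of_smul_eq_quadraticTwist W₀ W hd0 hC hyp.discr_odd
    (hyp.level ▸ hyp.coprime_level) hdD

/-! ## §2. Seat 01's twist theorems without the hypothesis `(N, D_L) = 1` -/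

variable {p : ℕ} [Fact p.Prime]

/-- **Reverse inclusion of the 9.10-`∅` twist clause** — seat 01's
`spanLeIdeal_perrinRiou_twist_of_idealLeSpan_of_thm1010_OPEN` with `(N, D_L) = 1` supplied from
`(d, D_L) = 1`. CONDITIONAL; closes nothing by itself. [claim: BurungaleSkinnerTianWan2024, status: under-review]
[cite: BurungaleSkinnerTianWan2024, Thm. 10.10, last sentence (p. 89; tex l.7525) with the proof of Thm. 10.8 (pp. 88–89) and Thm. 10.5, last sentence (p. 88)]
[cite: YanZhu2024MainConjNonCM, Lemma 5.3, Prop. 3.7 (arXiv:2412.20078v4 TeX l.1086–1093, l.821–829)] -/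
theorem spanLeIdeal_perrinRiou_twist_of_idealLeSpan_of_thm1010_OPEN_of_coprime
    (hO2 : thm1010_twist_mainStatement_OPEN)
    (h53 : lemma53_charIdeal_mul_charIdeal_le_toPlus_charIdeal)
    (h37 : prop37_cycRestrict_perrinRiou_eq_padicLFunction_mul)
    (hmodpar : nonempty_modularParametrizationData)
    (ι : integralClosure ℚ ℂ →+* ℂ_[p]) (W₀ W : WeierstrassCurve ℚ) [W₀.IsElliptic]
    [W₀.IsGloballyMinimal] [W.IsElliptic] [W.IsGloballyMinimal] (d : ℤ)
    (C : WeierstrassCurve.VariableChange ℚ) (K : Type) [Field K] [NumberField K]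
    (κ₁ κ₂ : ZpExtension K p) (γ₁ γ₂ : absoluteGaloisGroup K)
    [Fact (ZpExtension.IsTopGeneratorPair κ₁ κ₂ γ₁ γ₂)] {N₀ N : ℕ} [NeZero N]
    (π : ModularParametrizationData W N) (hyp : Thm1010bHypotheses W₀ p N₀ K) (hsq : Squarefree d)
    (hd1 : d ≠ 1) (hram : ∀ (q : ℕ) [Fact q.Prime], RamifiedInQuadratic d q → q ≠ p ∧ ¬ q ∣ N₀)
    (hC : C • W = W₀.quadraticTwist (d : ℚ)) (hN : (N : ℤ) = W.conductorNorm ℤ)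
    (hdD : IsCoprime d (NumberField.discr K))
    (hκ₁ : κ₁.IsCyclotomic) (hκ₂ : κ₂.IsAnticyclotomic) (κ : ZpExtension ℚ p) (hκ : κ.IsCyclotomic)
    (hγ : κ.IsTopGenerator (absGaloisRestrict ℚ K γ₁))
    (hγ' : IsCyclotomicVariable p (absGaloisRestrict ℚ K γ₁))
    {F : CycAntiSeries p} (hF : IsHidaRankinLFunction ι W κ₁ κ₂ π.f F)
    (hdiv : IdealLeSpan (WeierstrassCurve.XOrd₂.charIdeal (W.baseChange K) p κ₁ κ₂ γ₁ γ₂)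
      (perrinRiouLFunction W π F)) :
    SpanLeIdeal (perrinRiouLFunction W π F)
      (WeierstrassCurve.XOrd₂.charIdeal (W.baseChange K) p κ₁ κ₂ γ₁ γ₂) :=
  spanLeIdeal_perrinRiou_twist_of_idealLeSpan_of_thm1010_OPEN hO2 h53 h37 hmodpar ι W₀ W d C K κ₁ κ₂ γ₁
    γ₂ π hyp hsq hd1 hram hC hN hdD
    (isCoprime_level_discr_of_smul_eq_quadraticTwist hyp hsq.ne_zero hC hN hdD) hκ₁ hκ₂ κ hκ hγ hγ' hF
    hdiv

/-- **BSTW Thm. 10.10 (b), twist clause, statement 9.10 (`∅`) — the twist binder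
`thm1010b_twist_standardMainStatement_twoVariable_OPEN`'s conclusion for `g ⊗ χ_d`** (seat 01's
`twistStandardMainStatement_twoVariable_of_thm105_twist_OPEN_of_thm1010_OPEN` with `(N, D_L) = 1`
DISCHARGED): from the Thm. 10.5 twist binder `h105`, O2 at `d` and `d · D_L` (`hO2`), Yan–Zhu Cor. 2.9 /
Lemma 5.3 / Prop. 3.7, modularity — under `Thm1010bHypotheses W₀ p N₀ K`, the binder's own twist
conditions and the ONE extra `(d, D_L) = 1`, on the cyclotomic/anticyclotomic coordinates with `γ₁|_{ℚ_∞}`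
normalised. WEAKER than the binder by exactly `(d, D_L) = 1` and the coordinates. CONDITIONAL; closes
nothing by itself. [claim: BurungaleSkinnerTianWan2024, status: under-review]
[cite: BurungaleSkinnerTianWan2024, Thm. 10.10 (b), last sentence (p. 89; tex l.7523–7530) with statement 9.10 (p. 81) and Thm. 10.5, last sentence (p. 88)]
[cite: YanZhu2024MainConjNonCM, Cor. 2.9, Lemma 5.3, Prop. 3.7 (arXiv:2412.20078v4 TeX l.628–633, l.1086–1093, l.821–829)] -/
theorem twistStandardMainStatement_twoVariable_of_thm105_twist_OPEN_of_thm1010_OPEN_of_coprime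
    (h105 : thm105_twist_ordinary_twoVariableDivisibility_OPEN)
    (hO2 : thm1010_twist_mainStatement_OPEN) (h29 : cor29_XOrd₂_isTorsion)
    (h53 : lemma53_charIdeal_mul_charIdeal_le_toPlus_charIdeal)
    (h37 : prop37_cycRestrict_perrinRiou_eq_padicLFunction_mul)
    (hmodpar : nonempty_modularParametrizationData)
    (ι : integralClosure ℚ ℂ →+* ℂ_[p]) (W₀ W : WeierstrassCurve ℚ) [W₀.IsElliptic]
    [W₀.IsGloballyMinimal] [W.IsElliptic] [W.IsGloballyMinimal] (d : ℤ)
    (C : WeierstrassCurve.VariableChange ℚ) (K : Type) [Field K] [NumberField K]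
    (κ₁ κ₂ : ZpExtension K p) (γ₁ γ₂ : absoluteGaloisGroup K)
    [Fact (ZpExtension.IsTopGeneratorPair κ₁ κ₂ γ₁ γ₂)] {N₀ N : ℕ} [NeZero N]
    (π : ModularParametrizationData W N) (hyp : Thm1010bHypotheses W₀ p N₀ K) (hsq : Squarefree d)
    (hd1 : d ≠ 1) (hram : ∀ (q : ℕ) [Fact q.Prime], RamifiedInQuadratic d q → q ≠ p ∧ ¬ q ∣ N₀)
    (hC : C • W = W₀.quadraticTwist (d : ℚ)) (hN : (N : ℤ) = W.conductorNorm ℤ)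
    (hdD : IsCoprime d (NumberField.discr K))
    (hκ₁ : κ₁.IsCyclotomic) (hκ₂ : κ₂.IsAnticyclotomic) (κ : ZpExtension ℚ p) (hκ : κ.IsCyclotomic)
    (hγ : κ.IsTopGenerator (absGaloisRestrict ℚ K γ₁))
    (hγ' : IsCyclotomicVariable p (absGaloisRestrict ℚ K γ₁)) :
    Module.IsTorsion (IwasawaAlgebra₂ p) ((W.baseChange K).XOrd₂ p κ₁ κ₂ γ₁ γ₂) ∧
      ∀ F : CycAntiSeries p, IsHidaRankinLFunction ι W κ₁ κ₂ π.f F →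
        IdealLeSpan (WeierstrassCurve.XOrd₂.charIdeal (W.baseChange K) p κ₁ κ₂ γ₁ γ₂)
            (perrinRiouLFunction W π F) ∧
          SpanLeIdeal (perrinRiouLFunction W π F)
            (WeierstrassCurve.XOrd₂.charIdeal (W.baseChange K) p κ₁ κ₂ γ₁ γ₂) :=
  twistStandardMainStatement_twoVariable_of_thm105_twist_OPEN_of_thm1010_OPEN h105 hO2 h29 h53 h37 hmodpar
    ι W₀ W d C K κ₁ κ₂ γ₁ γ₂ π hyp hsq hd1 hram hC hN hdD
    (isCoprime_level_discr_of_smul_eq_quadraticTwist hyp hsq.ne_zero hC hN hdD) hκ₁ hκ₂ κ hκ hγ hγ'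

/-- **The same with O2 fed by REFEREED print** ([SU14] `hSU`, Greenberg–Vatsal `h5`/`h3`, modularity
`hmod`, Ribet–Diamond `hLL`; seat 01's `…_of_skinnerUrban` with `(N, D_L) = 1` DISCHARGED).
CONDITIONAL; closes nothing by itself. [claim: BurungaleSkinnerTianWan2024, status: under-review]
[cite: BurungaleSkinnerTianWan2024, Thm. 10.10 (b), last sentence, and Rem. 10.11 (p. 89); Thm. 10.5 (pp. 87–88)]
[cite: SkinnerUrban2014, Thm. 3.6.9; Lemma 3.1.7 (p. 20)] -/
theorem twistStandardMainStatement_twoVariable_of_thm105_twist_OPEN_of_skinnerUrban_of_coprime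
    (h105 : thm105_twist_ordinary_twoVariableDivisibility_OPEN)
    (hSU : ∀ (W : WeierstrassCurve ℚ) [W.IsElliptic] [W.IsGloballyMinimal] (p : ℕ) [Fact p.Prime]
      (κ : ZpExtension ℚ p) (γ : Field.absoluteGaloisGroup ℚ) (N : ℕ) [NeZero N]
      (f : CuspForm (Gamma0 N) 2),
      skinner_urban_main_conjecture W p (κ := κ) (γ := γ) (f := f))
    (h5 : realPeriodRat_eq_unit_mul_plusPeriod) (h3 : realPeriodRat_eq_unit_mul_plusPeriod_three)
    (hmod : exists_isNewformOf) (hLL : diamond1995_refinedSerre)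
    (h29 : cor29_XOrd₂_isTorsion) (h53 : lemma53_charIdeal_mul_charIdeal_le_toPlus_charIdeal)
    (h37 : prop37_cycRestrict_perrinRiou_eq_padicLFunction_mul)
    (hmodpar : nonempty_modularParametrizationData)
    (ι : integralClosure ℚ ℂ →+* ℂ_[p]) (W₀ W : WeierstrassCurve ℚ) [W₀.IsElliptic]
    [W₀.IsGloballyMinimal] [W.IsElliptic] [W.IsGloballyMinimal] (d : ℤ)
    (C : WeierstrassCurve.VariableChange ℚ) (K : Type) [Field K] [NumberField K]
    (κ₁ κ₂ : ZpExtension K p) (γ₁ γ₂ : absoluteGaloisGroup K)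
    [Fact (ZpExtension.IsTopGeneratorPair κ₁ κ₂ γ₁ γ₂)] {N₀ N : ℕ} [NeZero N]
    (π : ModularParametrizationData W N) (hyp : Thm1010bHypotheses W₀ p N₀ K) (hsq : Squarefree d)
    (hd1 : d ≠ 1) (hram : ∀ (q : ℕ) [Fact q.Prime], RamifiedInQuadratic d q → q ≠ p ∧ ¬ q ∣ N₀)
    (hC : C • W = W₀.quadraticTwist (d : ℚ)) (hN : (N : ℤ) = W.conductorNorm ℤ)
    (hdD : IsCoprime d (NumberField.discr K))
    (hκ₁ : κ₁.IsCyclotomic) (hκ₂ : κ₂.IsAnticyclotomic) (κ : ZpExtension ℚ p) (hκ : κ.IsCyclotomic)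
    (hγ : κ.IsTopGenerator (absGaloisRestrict ℚ K γ₁))
    (hγ' : IsCyclotomicVariable p (absGaloisRestrict ℚ K γ₁)) :
    Module.IsTorsion (IwasawaAlgebra₂ p) ((W.baseChange K).XOrd₂ p κ₁ κ₂ γ₁ γ₂) ∧
      ∀ F : CycAntiSeries p, IsHidaRankinLFunction ι W κ₁ κ₂ π.f F →
        IdealLeSpan (WeierstrassCurve.XOrd₂.charIdeal (W.baseChange K) p κ₁ κ₂ γ₁ γ₂)
            (perrinRiouLFunction W π F) ∧
          SpanLeIdeal (perrinRiouLFunction W π F)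
            (WeierstrassCurve.XOrd₂.charIdeal (W.baseChange K) p κ₁ κ₂ γ₁ γ₂) :=
  twistStandardMainStatement_twoVariable_of_thm105_twist_OPEN_of_thm1010_OPEN_of_coprime h105
    (thm1010_twist_mainStatement_OPEN_of_skinnerUrban hSU h5 h3 hmod hLL) h29 h53 h37 hmodpar ι W₀ W d C K
    κ₁ κ₂ γ₁ γ₂ π hyp hsq hd1 hram hC hN hdD hκ₁ hκ₂ κ hκ hγ hγ'

/-- **BSTW Thm. 10.10 (b), twist clause, statement 9.12 (`∅`) ("In particular Conj[.] Greenberg") — the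
twist binder `thm1010b_twist_greenbergMainStatement_twoVariable_OPEN`'s conclusion for `g ⊗ χ_d`**
(seat 01's `twistGreenbergMainStatement_twoVariable_of_thm105_twist_OPEN_of_thm1010_OPEN` with
`(N, D_L) = 1` DISCHARGED): under `Thm1010bHypotheses W₀ p N₀ K`, the binder's twist conditions, the
`ι`-prime data, THE cyclotomic/anticyclotomic pair with `γ₁|_{ℚ_∞}` normalised, `(d, D_L) = 1` and
`D_L ≠ −3`. WEAKER than the binder by exactly `(d, D_L) = 1`, `D_L ≠ −3` and the `γ₁`-normalisation.
CONDITIONAL; closes nothing by itself. [claim: BurungaleSkinnerTianWan2024, status: under-review]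
[cite: BurungaleSkinnerTianWan2024, Thm. 10.10 (b), last sentence (p. 89) with statement 9.12 (p. 81; l.6935–6944), proof of Thm. 10.8 last sentence (l.7513), Thm. 10.5 last sentence (p. 88)]
[cite: YanZhu2024MainConjNonCM, Thm. 4.7, Thm. 3.3, Cor. 2.9 (arXiv:2412.20078v4 TeX l.1022–1034, l.738–752, l.628–633)]
[cite: BurungaleCastellaSkinner2025, Thm. 4.1.3 (§4.1)] -/
theorem twistGreenbergMainStatement_twoVariable_of_thm105_twist_OPEN_of_thm1010_OPEN_of_coprime
    (h105 : thm105_twist_ordinary_twoVariableDivisibility_OPEN)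
    (hO2 : thm1010_twist_mainStatement_OPEN) (h29 : cor29_XOrd₂_isTorsion)
    (h33 : thm33_exists_isHidaRankinLFunction)
    (h53 : lemma53_charIdeal_mul_charIdeal_le_toPlus_charIdeal)
    (h37 : prop37_cycRestrict_perrinRiou_eq_padicLFunction_mul)
    (h47 : thm47_ord_localised_iff_greenbergAnyRoot_localised)
    (h413 : thm413_ord_torsion_dvd_iff_greenberg_torsion_dvd)
    (hmodpar : nonempty_modularParametrizationData)
    (ι₁ : integralClosure ℚ ℂ →+* ℂ_[p]) (ι : PadicAlgCl p ≃+* ℂ) (W₀ W : WeierstrassCurve ℚ)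
    [W₀.IsElliptic] [W₀.IsGloballyMinimal] [W.IsElliptic] [W.IsGloballyMinimal] (d : ℤ)
    (C : WeierstrassCurve.VariableChange ℚ) (K : Type) [Field K] [NumberField K]
    (v vbar : HeightOneSpectrum (𝓞 K)) (κ₁ κ₂ : ZpExtension K p) (γ₁ γ₂ : absoluteGaloisGroup K)
    [Fact (ZpExtension.IsTopGeneratorPair κ₁ κ₂ γ₁ γ₂)] {N₀ N : ℕ} [NeZero N]
    {f : CuspForm (Gamma0 N) 2} (hf : IsNewformOf W f) [NeZero (NumberField.discr K).natAbs]
    (hyp : Thm1010bHypotheses W₀ p N₀ K) (hsq : Squarefree d) (hd1 : d ≠ 1)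
    (hram : ∀ (q : ℕ) [Fact q.Prime], RamifiedInQuadratic d q → q ≠ p ∧ ¬ q ∣ N₀)
    (hC : C • W = W₀.quadraticTwist (d : ℚ)) (hN : (N : ℤ) = W.conductorNorm ℤ)
    (hdD : IsCoprime d (NumberField.discr K))
    (hv : ((p : ℕ) : 𝓞 K) ∈ v.asIdeal) (hvbar : ((p : ℕ) : 𝓞 K) ∈ vbar.asIdeal) (hne : vbar ≠ v)
    (hcompat : ∀ (w : InfinitePlace K) (k : 𝓞 K), k ∈ v.asIdeal ↔ ‖ι.symm (w.embedding (k : K))‖ < 1)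
    (hκ₁ : κ₁.IsCyclotomic) (hκ₂ : κ₂.IsAnticyclotomic) (hD3 : NumberField.discr K ≠ -3)
    (hι : ∀ z : integralClosure ℚ ℂ, ι₁ z = ((ι.symm (z : ℂ) : PadicAlgCl p) : ℂ_[p]))
    (κ : ZpExtension ℚ p) (hκ : κ.IsCyclotomic) (hγ : κ.IsTopGenerator (absGaloisRestrict ℚ K γ₁))
    (hγ' : IsCyclotomicVariable p (absGaloisRestrict ℚ K γ₁))
    {Ω δ : ℂ} {Ωp : (unrIntegers p)ˣ} {LK G' : PowerSeries (PowerSeries (PadicComplexInt p))}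
    (hLK : IsKatzMeasure₂ ι v vbar ∅ κ₁ κ₂ γ₁⁻¹ γ₂⁻¹ 1 Ω δ ((Ωp : unrIntegers p) : ℂ_[p]) LK)
    (hG : IsGreenbergLFunctionAnyRoot₂ ι v vbar κ₁ κ₂ γ₁⁻¹ γ₂⁻¹ f (NumberField.discr K).natAbs
      (NumberField.classNumber K) LK G')
    (J : ℤ_[p] →+* PadicComplexInt p)
    (hJ : ∀ x : ℤ_[p], ((J x : PadicComplexInt p) : ℂ_[p]) = ((x : ℚ_[p]) : ℂ_[p])) :
    Module.IsTorsion (IwasawaAlgebra₂ p) ((W.baseChange K).XGr₂ p κ₁ κ₂ vbar γ₁ γ₂) ∧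
      (WeierstrassCurve.XGr₂.charIdeal (W.baseChange K) p κ₁ κ₂ vbar γ₁ γ₂).map (toUnr₂ p J) =
        Ideal.span {G'} :=
  twistGreenbergMainStatement_twoVariable_of_thm105_twist_OPEN_of_thm1010_OPEN h105 hO2 h29 h33 h53 h37
    h47 h413 hmodpar ι₁ ι W₀ W d C K v vbar κ₁ κ₂ γ₁ γ₂ hf hyp hsq hd1 hram hC hN hdD
    (isCoprime_level_discr_of_smul_eq_quadraticTwist hyp hsq.ne_zero hC hN hdD) hv hvbar hne hcompat hκ₁
    hκ₂ hD3 hι κ hκ hγ hγ' hLK hG J hJ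

/-- **The same with O2 fed by REFEREED print** ([SU14] `hSU`, `h5`, `h3`, `hmod`, `hLL`; seat 01's
`…_of_skinnerUrban` with `(N, D_L) = 1` DISCHARGED). CONDITIONAL; closes nothing by itself.
[claim: BurungaleSkinnerTianWan2024, status: under-review]
[cite: BurungaleSkinnerTianWan2024, Thm. 10.10 (b), last sentence, and Rem. 10.11 (p. 89); Thm. 10.5 (pp. 87–88)]
[cite: YanZhu2024MainConjNonCM, Thm. 4.7 (arXiv:2412.20078v4 TeX l.1022–1034)] [cite: BurungaleCastellaSkinner2025, Thm. 4.1.3 (§4.1)] -/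
theorem twistGreenbergMainStatement_twoVariable_of_thm105_twist_OPEN_of_skinnerUrban_of_coprime
    (h105 : thm105_twist_ordinary_twoVariableDivisibility_OPEN)
    (hSU : ∀ (W : WeierstrassCurve ℚ) [W.IsElliptic] [W.IsGloballyMinimal] (p : ℕ) [Fact p.Prime]
      (κ : ZpExtension ℚ p) (γ : Field.absoluteGaloisGroup ℚ) (N : ℕ) [NeZero N]
      (f : CuspForm (Gamma0 N) 2),
      skinner_urban_main_conjecture W p (κ := κ) (γ := γ) (f := f))
    (h5 : realPeriodRat_eq_unit_mul_plusPeriod) (h3 : realPeriodRat_eq_unit_mul_plusPeriod_three)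
    (hmod : exists_isNewformOf) (hLL : diamond1995_refinedSerre)
    (h29 : cor29_XOrd₂_isTorsion) (h33 : thm33_exists_isHidaRankinLFunction)
    (h53 : lemma53_charIdeal_mul_charIdeal_le_toPlus_charIdeal)
    (h37 : prop37_cycRestrict_perrinRiou_eq_padicLFunction_mul)
    (h47 : thm47_ord_localised_iff_greenbergAnyRoot_localised)
    (h413 : thm413_ord_torsion_dvd_iff_greenberg_torsion_dvd)
    (hmodpar : nonempty_modularParametrizationData)
    (ι₁ : integralClosure ℚ ℂ →+* ℂ_[p]) (ι : PadicAlgCl p ≃+* ℂ) (W₀ W : WeierstrassCurve ℚ)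
    [W₀.IsElliptic] [W₀.IsGloballyMinimal] [W.IsElliptic] [W.IsGloballyMinimal] (d : ℤ)
    (C : WeierstrassCurve.VariableChange ℚ) (K : Type) [Field K] [NumberField K]
    (v vbar : HeightOneSpectrum (𝓞 K)) (κ₁ κ₂ : ZpExtension K p) (γ₁ γ₂ : absoluteGaloisGroup K)
    [Fact (ZpExtension.IsTopGeneratorPair κ₁ κ₂ γ₁ γ₂)] {N₀ N : ℕ} [NeZero N]
    {f : CuspForm (Gamma0 N) 2} (hf : IsNewformOf W f) [NeZero (NumberField.discr K).natAbs]
    (hyp : Thm1010bHypotheses W₀ p N₀ K) (hsq : Squarefree d) (hd1 : d ≠ 1)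
    (hram : ∀ (q : ℕ) [Fact q.Prime], RamifiedInQuadratic d q → q ≠ p ∧ ¬ q ∣ N₀)
    (hC : C • W = W₀.quadraticTwist (d : ℚ)) (hN : (N : ℤ) = W.conductorNorm ℤ)
    (hdD : IsCoprime d (NumberField.discr K))
    (hv : ((p : ℕ) : 𝓞 K) ∈ v.asIdeal) (hvbar : ((p : ℕ) : 𝓞 K) ∈ vbar.asIdeal) (hne : vbar ≠ v)
    (hcompat : ∀ (w : InfinitePlace K) (k : 𝓞 K), k ∈ v.asIdeal ↔ ‖ι.symm (w.embedding (k : K))‖ < 1)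
    (hκ₁ : κ₁.IsCyclotomic) (hκ₂ : κ₂.IsAnticyclotomic) (hD3 : NumberField.discr K ≠ -3)
    (hι : ∀ z : integralClosure ℚ ℂ, ι₁ z = ((ι.symm (z : ℂ) : PadicAlgCl p) : ℂ_[p]))
    (κ : ZpExtension ℚ p) (hκ : κ.IsCyclotomic) (hγ : κ.IsTopGenerator (absGaloisRestrict ℚ K γ₁))
    (hγ' : IsCyclotomicVariable p (absGaloisRestrict ℚ K γ₁))
    {Ω δ : ℂ} {Ωp : (unrIntegers p)ˣ} {LK G' : PowerSeries (PowerSeries (PadicComplexInt p))}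
    (hLK : IsKatzMeasure₂ ι v vbar ∅ κ₁ κ₂ γ₁⁻¹ γ₂⁻¹ 1 Ω δ ((Ωp : unrIntegers p) : ℂ_[p]) LK)
    (hG : IsGreenbergLFunctionAnyRoot₂ ι v vbar κ₁ κ₂ γ₁⁻¹ γ₂⁻¹ f (NumberField.discr K).natAbs
      (NumberField.classNumber K) LK G')
    (J : ℤ_[p] →+* PadicComplexInt p)
    (hJ : ∀ x : ℤ_[p], ((J x : PadicComplexInt p) : ℂ_[p]) = ((x : ℚ_[p]) : ℂ_[p])) :
    Module.IsTorsion (IwasawaAlgebra₂ p) ((W.baseChange K).XGr₂ p κ₁ κ₂ vbar γ₁ γ₂) ∧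
      (WeierstrassCurve.XGr₂.charIdeal (W.baseChange K) p κ₁ κ₂ vbar γ₁ γ₂).map (toUnr₂ p J) =
        Ideal.span {G'} :=
  twistGreenbergMainStatement_twoVariable_of_thm105_twist_OPEN_of_thm1010_OPEN_of_coprime h105
    (thm1010_twist_mainStatement_OPEN_of_skinnerUrban hSU h5 h3 hmod hLL) h29 h33 h53 h37 h47 h413 hmodpar
    ι₁ ι W₀ W d C K v vbar κ₁ κ₂ γ₁ γ₂ hf hyp hsq hd1 hram hC hN hdD hv hvbar hne hcompat hκ₁ hκ₂ hD3 hι κ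
    hκ hγ hγ' hLK hG J hJ

end Literature.NumberTheory.EllipticCurves.BurungaleSkinnerTianWan2024

end
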